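import Mathlib.LinearAlgebra.Charpoly.Basic
import Mathlib.Algebra.Polynomial.Reverse
import Mathlib.Algebra.Polynomial.AlgebraMap
import Mathlib.GroupTheory.Commutator.Basic
import Mathlib.RepresentationTheory.Basic
import Mathlib.Tactic.Group
import Literature.NumberTheory.GaloisRepresentations.ContinuousCorestriction
import Literature.NumberTheory.GaloisRepresentations.GaloisRep
import HarnessLib

/-!
# Euler systems for `p`-adic Galois representations (Rubin, *Euler Systems*, Def. 2.1.1)

Let `K` be a number field, `Γ_K = Field.absoluteGaloisGroup K`, and let `T` be a `p`-adic
representation of `Γ_K`: here any `T : GaloisRep K A M` (a continuous `A`-linear representation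
on a topological `A`-module `M`, `A` a commutative topological ring; Rubin: `A = O` the ring of
integers of a finite extension of `ℚ_p`, `M` free of finite rank).  Galois cohomology of `T` over a
finite extension `F ⊂ K̄` of `K` is the **continuous-cochain cohomology**
`H¹(F, T) = H¹(Gal(K̄/F), T)` (Rubin, Ch. I §2 and App. B), i.e. Mathlib's
`continuousCohomology 1` of `T` restricted to the open subgroup `Gal(K̄/F) ≤ Γ_K`
(`Literature.NumberTheory.GaloisRepresentations.H1`; file `ContinuousCorestriction` supplies
restriction, the `Gal(F/K)`-action `conjMap` and the corestriction `coresLe`).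

## The definition vendored (Rubin 2000, Def. 2.1.1 with Remarks 2.1.3–2.1.4)

Rubin fixes an ideal `N` of `K` (divisible by `p` and the primes where `T` ramifies) and an
abelian extension `𝒦/K` containing a `ℤ_p^d`-extension `K_∞/K` and, for every prime `q ∤ N`, the
field `K(q)` (the maximal `p`-subextension of the ray class field modulo `q`; `K(q)/K` is
unramified outside `q`).  An **Euler system for `(T, 𝒦, N)`** is a collection
`{c_F ∈ H¹(F, T) : K ⊂_f F ⊂ 𝒦}` such that for `F ⊂_f F'`,
`Cor_{F'/F} c_{F'} = (∏_{q ∈ Σ(F'/F)} P(Fr_q⁻¹ | T*; Fr_q⁻¹)) c_F`, where `Σ(F'/F)` is the set of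
primes `q ∤ N` ramified in `F'/K` but not in `F/K`, `T* = Hom_O(T, O(1))`,
`P(τ | B; X) = det(1 - τX | B)` and `Fr_q ∈ Γ_K` is an (arithmetic) Frobenius of `q`
[Rubin2000, Def. 2.1.1; Ch. I Def. 1.3; Ch. III §2.1: for `T = ℤ_p(1)`, `P = 1 - X` and the
relation is `N(ζ_{mℓ} - 1) = (ζ_m - 1)^{1 - Fr_ℓ⁻¹}`].  By Remark 2.1.4, for
`𝒦 = 𝒦_min = K_∞ · ∏ K(q)` such a system is the same as classes `c_{F(r)} ∈ H¹(F(r), T)` for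
`K ⊂_f F ⊂ K_∞` and `r` a squarefree product of primes `∤ N` (`F(r) = F·K(q₁)⋯K(q_k)`), subject to
the two **one-step relations** `Cor_{F(rq)/F(r)} c_{F(rq)} = P(Fr_q⁻¹ | T*; Fr_q⁻¹) c_{F(r)}` and
`Cor_{F'(r)/F(r)} c_{F'(r)} = c_{F(r)}` (Euler system classes are universal norms in the
`K_∞`-direction).  Over `K = ℚ` with the tower `ℚ(μ_{r p^k})` this is the familiar
`{c_m ∈ H¹(ℚ(μ_m), T) : m = r p^k}` (Rubin's PCMI lectures, §4.1; Kato).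

This file formalises exactly this one-step ("cyclotomic tower") shape, with the tower as data:

* `EulerSystemLevels K ι` — the levels: a set `primes` of usable primes of `K` (Rubin: `q ∤ N`;
  Mazur–Rubin: `𝒫`), the `K_∞`-direction levels `pLevel : ι → Subgroup Γ_K` (`ι` a preorder with
  `⊥`; `pLevel ⊥ = ⊤`, antitone; Rubin: the finite layers of `K_∞/K`, `ι = ℕ` when `d = 1`) and
  the tame levels `tameLevel q = Gal(K̄/K(q))`; all open with abelian quotient (`𝒦/K` abelian),
  `pLevel i` unramified at every `v ∈ primes` (`K_∞/K` is unramified outside `p ∣ N`) and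
  `tameLevel q` unramified at every `v ∈ primes ∖ {q}` (`K(q)/K` is unramified outside `q`).
  The level of the index `(i, r)` is `level i r = pLevel i ⊓ ⨅_{q ∈ r} tameLevel q`
  (`= Gal(K̄/F_i(r))`, composita of fields being intersections of subgroups).
* `twistedDual ρ χ` — `T* = Hom_A(T, A(χ))`, `(σ f)(m) = χ(σ) f(σ⁻¹ m)`, with `χ` the `p`-adic
  cyclotomic character (`cyclotomicCharacterToUnits`); `rubinP τ = det(1 - τ X)`
  (`= τ.charpoly.reverse`, Mathlib `Matrix.reverse_charpoly`); the **Euler factor**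
  `rubinEulerFactor ρ χ σ = P(σ⁻¹ | T*; X)` for `σ` an arithmetic Frobenius
  (`IsArithFrobAtPlace K v σ`, Mathlib `IsArithFrobAt` at a prime of `\bar ℤ_K` above `v`).
* `frobeniusInvOp T U σ` — the operator `Fr_q⁻¹ = σ⁻¹` on `H¹(U, T)` (`Gal`-action `conjMap`) and
  `eulerFactorOp T U p σ = P(Fr_q⁻¹ | T*; Fr_q⁻¹) ∈ End_A H¹(U, T)` (`Polynomial.aeval`).
* `IsEulerSystem L T p c` — **the definition**: for a family
  `c i r ∈ H¹(level i r, T)` (`r : L.Ideals`, finite sets of usable primes = squarefree ideals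
  prime to `N`), (a) `Cor c_{j,r} = c_{i,r}` for `i ≤ j`; (b) for `q ∈ primes`, `q ∉ r`:
  `Cor c_{i,rq} = c_{i,r}` if `F_i(rq)/K` is still unramified at `q` (then `Σ = ∅`; e.g.
  `K(q) = K`), and `Cor c_{i,rq} = P(Fr_q⁻¹ | T*; Fr_q⁻¹) c_{i,r}` — for every arithmetic Frobenius
  `Fr_q` of `q` in `Γ_K` — if `q` ramifies in `F_i(rq)` (then `Σ = {q}` by the unramifiedness
  axioms, `level_unramifiedAt`).  This is Rubin's Def. 2.1.1 imposed on the covering pairs of the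
  index set, i.e. the Remark 2.1.4 description; `EulerSystem L T p` is the `A`-module of Euler
  systems (Rubin/PCMI: `ES(T)`).
* `IsEulerSystem.bottomClass` — the class `c_K ∈ H¹(K, T) = H¹(Γ_K, T)`;
  `GaloisRep.localizeH T v n : Hⁿ(K, T) ⟶ Hⁿ(K_v, T)` — localisation at a finite place, so that
  "the bottom class has image `ℒ` under a functional `Λ : H¹(K_v, T) →ₗ[A] A`" reads
  `Λ (T.localizeH v 1 (hc.bottomClass)) = ℒ` (`IsEulerSystem.HasBottomValue`).

## Conventions and scope (read before use)

* **Frobenius.** `Fr_q` is the *arithmetic* Frobenius (`x ↦ x^{Nq} mod 𝔓`), as in Rubin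
  (Ch. III §2.1) and in the tree (`GaloisRep.HasFrobCharpolyAt`).  Since `Frob` is only defined up
  to conjugacy and inertia, the tame relation is required for **every** `σ ∈ Γ_K` with
  `IsArithFrobAt (𝓞 K) σ 𝔓`, `𝔓 ∣ q`; when `Γ_K ⧸ level` is abelian, `q ∉ r ∪ N` and `T` is
  unramified at `q`, all these give the same operator (`frobeniusInvOp_eq_of_inv_mul_mem`,
  `frobeniusInvOp_conj_eq`, `eulerFactorOp_eq_of_inv_mul_mem`; inner automorphisms act trivially,
  `conjMap_one_apply_of_mem`), so this is Rubin's single relation (and it is never vacuous: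
  Frobenius elements exist, `exists_isArithFrobAt_of_mem_primesAbove_holds`).
* **Euler factor.** Rubin's `P(Fr_q⁻¹ | T*; X) = det(1 - Fr_q⁻¹ X | Hom(T, O(1)))`
  `= det(1 - χ_cyc(Fr_q)⁻¹ Fr_q X | T)` (`= det(1 - Nq⁻¹ Fr_q X | T)`); e.g. `1 - X` for
  `T = ℤ_p(1)` and `1 - a_q q⁻¹ X + q⁻¹ X²` for `T = T_p(E)`.  Rubin's Park City lectures
  (Rubin 2011, §4.1, over `ℚ`: `P_ℓ(x) = det(1 - Fr_ℓ x | A)`, written in the conventions of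
  Mazur–Rubin, *Kolyvagin systems* (2004), which we could not consult — paywalled) use
  `det(1 - Fr_q X | T)` instead; the two notions differ by the substitution `X ↦ χ_cyc(Fr_q) X`
  (Rubin, Ch. IX §6 discusses varying the Euler factors).  This file follows the book [Rubin2000],
  as requested by the consuming route.
* **The action on `H¹(F, T)`.** `γ ∈ Gal(F/K)` acts by `(γ̃ · φ)(h) = γ̃ φ(γ̃⁻¹ h γ̃)` on cocycles
  (`conjMap`), the standard `O[Gal(F/K)]`-module structure (for `T = ℤ_p(1)` and Kummer theory it
  is `γ · x = γ(x)` on `F^× ⊗ ℤ_p`); `Fr_q⁻¹` therefore acts as `conjMap _ _ σ⁻¹`.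
* **What is deliberately NOT here.** (i) Rubin's hypotheses (i)–(ii) of Def. 2.1.1 on `𝒦`
  (`𝒦 ⊇ K(q)`, `Gal(K_∞/K) ≅ ℤ_p^d`, no finite prime splits completely in `K_∞`) and
  `N ⊇ {p, ramified primes of T}` are hypotheses of his *theorems* (Thm. 2.2.2 ff.), not of the
  notion; they are not fields of `EulerSystemLevels` (ray class fields modulo `q` are not yet in
  the tree).  (ii) Towers in which one tame step ramifies several usable primes at once (e.g.
  `K(μ_ℓ)/K` with `ℓ` split in `K`) are excluded by `tameLevel_unramifiedAt`, exactly as for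
  Rubin's `K(q)`; the general product relation of Def. 2.1.1 for arbitrary pairs `F ⊂ F'` is then a
  consequence (transitivity of `Cor`), not restated here.  (iii) No Kolyvagin derivative classes,
  Selmer bounds or `p`-adic `L`-functions (Rubin Ch. IV–VIII).

## References

* K. Rubin, *Euler Systems*, Annals of Math. Studies 147 (2000): Ch. I Def. 1.1, 1.3, §2, App. B
  (continuous cohomology); Ch. II §1 = Def. 2.1.1, Remarks 2.1.2–2.1.4; Ch. III §2.1 (cyclotomic
  units, Frobenius convention). [Rubin2000]
* K. Rubin, *Euler systems and Kolyvagin systems*, in *Arithmetic of L-functions*, IAS/Park City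
  Math. Ser. 18 (2011), 449–499 (2009 lectures; author's version read), §3.1 (`H¹(G, A) =
  lim H¹(G, A/p^m)` "is the same group one would get using continuous cocycles"), §4.1 (the
  definition over `ℚ`, `𝒩 = {n p^k}`). [Rubin2011]
* B. Mazur, K. Rubin, *Kolyvagin systems*, Mem. AMS 799 (2004), §3.2, Def. 3.2.2 (Euler systems for
  `(T, 𝒦, 𝒫)`; named by the requesting route, not consulted here). [MazurRubin2004]
* J.-P. Serre, *Local Fields* (1979), VII.§5–§7 (the `G/H`-action, corestriction).
-/

noncomputable section

open CategoryTheory Field IsDedekindDomain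
open scoped NumberField Polynomial Classical

universe u v w

namespace Literature.NumberTheory.GaloisRepresentations

/-! ## Rubin's `P(τ | B; X)`, the twisted dual `T*` and the Euler factor -/

section EulerFactor

variable {A : Type v} [CommRing A] {Γ : Type*} [Group Γ]
variable {M : Type w} [AddCommGroup M] [Module A M]

/-- Rubin's notation `P(τ | B; X) = det(1 - τ X | B) ∈ A[X]` for an endomorphism `τ` of a finite
free `A`-module `B`: the reverse of the characteristic polynomial (`det(1 - Xτ) = X^n χ_τ(1/X)`,
Mathlib `Matrix.reverse_charpoly`; same shape as the tree's Euler factors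
`ArtinRep.eulerFactorAt`, `FrobeniusTrace.frobCharPoly`).
Ref: Rubin, *Euler Systems* (2000), Introduction, Notation. [cite: Rubin2000, Introduction (Notation)] -/
def rubinP [Module.Free A M] [Module.Finite A M] (τ : Module.End A M) : A[X] :=
  τ.charpoly.reverse

/-- Unfolding `rubinP`. [folklore] -/
theorem rubinP_def [Module.Free A M] [Module.Finite A M] (τ : Module.End A M) :
    rubinP τ = τ.charpoly.reverse :=
  rfl

/-- The **twisted dual** representation `T* = Hom_A(T, A(χ))` of `ρ` by a character `χ : Γ → Aˣ`:
`(σ · f)(m) = χ(σ) f(σ⁻¹ m)` on `Module.Dual A M` (Mathlib `Representation.dual`, twisted by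
`χ`).  For `χ = χ_cyc` the `p`-adic cyclotomic character this is Rubin's `T* = Hom_O(T, O(1))`.
Ref: Rubin, *Euler Systems* (2000), Ch. I Def. 1.3 and Example 1.4 (`(O_ρ)* = O_{ρ⁻¹ ε_cyc}`).
[cite: Rubin2000, Ch. I Def. 1.3] -/
def twistedDual (ρ : Representation A Γ M) (χ : Γ →* Aˣ) : Representation A Γ (Module.Dual A M) where
  toFun σ := ((χ σ : Aˣ) : A) • ρ.dual σ
  map_one' := by rw [map_one, map_one, Units.val_one, one_smul]
  map_mul' σ τ := by
    refine LinearMap.ext fun f ↦ LinearMap.ext fun m ↦ ?_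
    simp only [map_mul, Units.val_mul, LinearMap.smul_apply, Module.End.mul_apply,
      LinearMap.map_smul, smul_smul]

/-- Unfolding `twistedDual`: `(σ · f)(m) = χ(σ) f(ρ(σ⁻¹) m)`. [folklore] -/
@[simp]
theorem twistedDual_apply_apply (ρ : Representation A Γ M) (χ : Γ →* Aˣ) (σ : Γ)
    (f : Module.Dual A M) (m : M) :
    twistedDual ρ χ σ f m = ((χ σ : Aˣ) : A) * f (ρ σ⁻¹ m) :=
  rfl

/-- The **Euler factor** `P(σ⁻¹ | T*; X) = det(1 - σ⁻¹ X | Hom_A(T, A(χ))) ∈ A[X]` attached to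
`σ ∈ Γ` (an arithmetic Frobenius `Fr_q`), Rubin's convention: for `χ = χ_cyc` it equals
`det(1 - χ(σ)⁻¹ σ X | T)`, e.g. `1 - X` for `T = ℤ_p(1)` [Rubin2000, Ch. III §2.1] and
`1 - a_q q⁻¹ X + q⁻¹ X²` for the Tate module of an elliptic curve [Rubin2000, Ch. III §5].
Ref: Rubin, *Euler Systems* (2000), Ch. II §1 (display before Def. 1.1 = book Def. 2.1.1).
[cite: Rubin2000, Def. 2.1.1] -/
def rubinEulerFactor [Module.Free A M] [Module.Finite A M] (ρ : Representation A Γ M) (χ : Γ →* Aˣ)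
    (σ : Γ) : A[X] :=
  rubinP (twistedDual ρ χ σ⁻¹)

/-- Unfolding `rubinEulerFactor`: `P(σ⁻¹ | T*; X)` is the reversed characteristic polynomial of
`f ↦ χ(σ)⁻¹ · f ∘ ρ(σ)` on `Module.Dual A M`. [folklore] -/
theorem rubinEulerFactor_eq [Module.Free A M] [Module.Finite A M] (ρ : Representation A Γ M)
    (χ : Γ →* Aˣ) (σ : Γ) :
    rubinEulerFactor ρ χ σ = (((((χ σ)⁻¹ : Aˣ) : A) • (ρ σ).dualMap).charpoly).reverse := by
  change ((twistedDual ρ χ σ⁻¹).charpoly).reverse = _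
  congr 2
  refine LinearMap.ext fun f ↦ LinearMap.ext fun m ↦ ?_
  simp only [twistedDual_apply_apply, inv_inv, map_inv, LinearMap.smul_apply,
    LinearMap.dualMap_apply, smul_eq_mul]

end EulerFactor

/-! ## Complements on the `G`-action on `H¹(H, X)`: inner automorphisms act trivially -/

section Inner

variable {R : Type v} [Ring R] [TopologicalSpace R]
variable {G : Type u} [Group G] [TopologicalSpace G] [IsTopologicalGroup G]
variable (X : TopRep.{u} R G) (H : Subgroup G) [H.Normal]

/-- **Inner automorphisms act trivially on `H¹`.**  For `g ∈ H` the action of `g` on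
`H¹(H, X)` is the identity: on a crossed homomorphism `φ`,
`g • φ(g⁻¹ h g) - φ(h) = h • φ(g) - φ(g)` is a coboundary.  Hence `conjMap` is an action of
`G ⧸ H`.  Ref: Serre, *Local Fields* (1979), VII.§5, Prop. 3; Neukirch–Schmidt–Wingberg (2008),
(1.6.3). [folklore] -/
theorem conjMap_one_apply_of_mem (g : H) (c : continuousCohomology 1 (subgroupRep X H)) :
    conjMap X H (g : G) 1 c = c := by
  obtain ⟨φ, rfl⟩ := oneCocycleClass_surjective _ c
  rw [conjMap_oneCocycleClass, ← sub_eq_zero, ← oneCocycleClass_sub, oneCocycleClass_eq_zero_iff]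
  refine ⟨φ.1 g, fun h ↦ ?_⟩
  have hconj : (Literature.NumberTheory.EllipticCurves.subgroupConj H (g : G) h : H) = g⁻¹ * (h * g) :=
    Subtype.ext (by simp [mul_assoc])
  have hinv : X.ρ (g : G) (φ.1 g⁻¹) = -φ.1 g := by
    have h1 := φ.2 g g⁻¹
    rw [mul_inv_cancel, contOneCocycles.apply_one] at h1
    rw [eq_neg_iff_add_eq_zero, add_comm]
    exact h1.symm
  rw [Submodule.coe_sub, ContinuousMap.sub_apply, conj_pullback_apply, hconj, φ.2, φ.2]
  simp only [map_add, hinv, ContRepresentation.restrict_apply_apply, Subgroup.coe_subtype,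
    Subgroup.coe_inv, ρ_apply_ρ_inv_apply]
  abel

/-- `conjMap` is a left action in degree one: `(ab) · c = a · (b · c)` on `H¹(H, X)`.
Ref: Serre, *Local Fields* (1979), VII.§5. [folklore] -/
theorem conjMap_mul_apply_one (a b : G) (c : continuousCohomology 1 (subgroupRep X H)) :
    conjMap X H (a * b) 1 c = conjMap X H a 1 (conjMap X H b 1 c) := by
  obtain ⟨φ, rfl⟩ := oneCocycleClass_surjective _ c
  rw [conjMap_oneCocycleClass, conjMap_oneCocycleClass, conjMap_oneCocycleClass]
  congr 1
  refine Subtype.ext (ContinuousMap.ext fun h ↦ ?_)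
  have hc : Literature.NumberTheory.EllipticCurves.subgroupConj H (a * b) h =
      Literature.NumberTheory.EllipticCurves.subgroupConj H b
        (Literature.NumberTheory.EllipticCurves.subgroupConj H a h) :=
    Subtype.ext (by simp [mul_assoc])
  rw [conj_pullback_apply, conj_pullback_apply, conj_pullback_apply, hc, ρ_mul_apply]

/-- The action of `b` on `H¹(H, X)` only depends on the coset `bH = aH`.
Ref: Serre, *Local Fields* (1979), VII.§5, Prop. 3. [folklore] -/
theorem conjMap_apply_one_eq_of_inv_mul_mem {a b : G} (hab : a⁻¹ * b ∈ H)
    (c : continuousCohomology 1 (subgroupRep X H)) : conjMap X H b 1 c = conjMap X H a 1 c := by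
  have e : b = a * (a⁻¹ * b) := by group
  rw [e, conjMap_mul_apply_one, conjMap_one_apply_of_mem X H ⟨a⁻¹ * b, hab⟩]

end Inner

/-! ## Frobenius elements at a place; unramified subgroups; the cyclotomic character in `A` -/

section Places

variable (K : Type u) [Field K]

/-- `σ ∈ Γ_K` is an **arithmetic Frobenius element at the finite place `v`**: for some prime `𝔓`
of `\bar ℤ_K` above `v`, `σ • x ≡ x ^ {Nv} (mod 𝔓)` for all `x ∈ \bar ℤ_K` (Mathlib
`IsArithFrobAt`, tree `HeightOneSpectrum.primesAbove`).  Such `σ` exist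
(`exists_isArithFrobAt_of_mem_primesAbove_holds`) and form one `Γ_K`-conjugacy class up to
inertia.  Ref: Serre, *Abelian ℓ-adic representations* (1968), Ch. I §2.1; Rubin, *Euler
Systems* (2000), Ch. II §1 ("let `Fr_q` denote a Frobenius of `q` in `G_K`"). [folklore] -/
def IsArithFrobAtPlace [NumberField K] (v : HeightOneSpectrum (𝓞 K)) (σ : absoluteGaloisGroup K) :
    Prop :=
  ∃ 𝔓 ∈ v.primesAbove, IsArithFrobAt (𝓞 K) σ 𝔓

/-- The closed subgroup `U ≤ Γ_K` (i.e. its fixed field `F = K̄^U`) is **unramified at the finite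
place `v`**: every inertia group `I_𝔓 ≤ Γ_K`, `𝔓 ∣ v`, is contained in `U`.  For `U` normal it
suffices to test one `𝔓`.  Ref: Serre, *Local Fields* (1979), I.§7–§8; Rubin, *Euler Systems*
(2000), Ch. II §1 (`Σ(F'/F)`: primes ramifying in `F'/K` but not in `F/K`). [folklore] -/
def SubgroupIsUnramifiedAt [NumberField K] (U : Subgroup (absoluteGaloisGroup K))
    (v : HeightOneSpectrum (𝓞 K)) : Prop :=
  ∀ 𝔓 ∈ v.primesAbove, 𝔓.inertia (absoluteGaloisGroup K) ≤ U

variable {K} in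
/-- An intersection of subgroups unramified at `v` is unramified at `v`. [folklore] -/
theorem SubgroupIsUnramifiedAt.inf [NumberField K] {U U' : Subgroup (absoluteGaloisGroup K)}
    {v : HeightOneSpectrum (𝓞 K)} (hU : SubgroupIsUnramifiedAt K U v)
    (hU' : SubgroupIsUnramifiedAt K U' v) : SubgroupIsUnramifiedAt K (U ⊓ U') v :=
  fun 𝔓 h𝔓 ↦ le_inf (hU 𝔓 h𝔓) (hU' 𝔓 h𝔓)

variable {K} in
/-- A subgroup containing a subgroup unramified at `v` is unramified at `v`. [folklore] -/
theorem SubgroupIsUnramifiedAt.mono [NumberField K] {U U' : Subgroup (absoluteGaloisGroup K)}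
    {v : HeightOneSpectrum (𝓞 K)} (hU : SubgroupIsUnramifiedAt K U v) (h : U ≤ U') :
    SubgroupIsUnramifiedAt K U' v :=
  fun 𝔓 h𝔓 ↦ (hU 𝔓 h𝔓).trans h

/-- The whole group is unramified everywhere (`K/K` is unramified). [folklore] -/
theorem subgroupIsUnramifiedAt_top [NumberField K] (v : HeightOneSpectrum (𝓞 K)) :
    SubgroupIsUnramifiedAt K (⊤ : Subgroup (absoluteGaloisGroup K)) v :=
  fun _ _ ↦ le_top

/-- The `p`-adic cyclotomic character with values in the units of a `ℤ_p`-algebra `A`: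
`Γ_K → ℤ_pˣ → Aˣ` (tree `GaloisRep.cyclotomicCharacter`, Mathlib `cyclotomicCharacter`).  This
is the character by which `Γ_K` acts on Rubin's `O(1) = O ⊗ ℤ_p(1)`.
Ref: Rubin, *Euler Systems* (2000), Ch. I §1 (Example 1.2, `O(1)`). [folklore] -/
def cyclotomicCharacterToUnits (p : ℕ) [Fact p.Prime] (A : Type v) [CommRing A] [Algebra ℤ_[p] A] :
    absoluteGaloisGroup K →* Aˣ :=
  (Units.map (algebraMap ℤ_[p] A : ℤ_[p] →* A)).comp
    (GaloisRep.cyclotomicCharacter K p).toMonoidHom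

/-- Unfolding `cyclotomicCharacterToUnits`. [folklore] -/
@[simp]
theorem coe_cyclotomicCharacterToUnits_apply (p : ℕ) [Fact p.Prime] (A : Type v) [CommRing A]
    [Algebra ℤ_[p] A] (σ : absoluteGaloisGroup K) :
    ((cyclotomicCharacterToUnits K p A σ : Aˣ) : A) =
      algebraMap ℤ_[p] A ((GaloisRep.cyclotomicCharacter K p σ : ℤ_[p]ˣ) : ℤ_[p]) :=
  rfl

end Places

/-! ## Open subgroups of a compact group have finite index -/

section FiniteIndex

variable {G : Type*} [Group G] [TopologicalSpace G] [IsTopologicalGroup G]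

/-- An open subgroup of a compact topological group has finite index (the coset space is compact
and discrete).  Ref: Serre, *Galois Cohomology* (1997), I.§1.1. [folklore] -/
theorem finiteIndex_of_isOpen_of_compactSpace [CompactSpace G] (U : Subgroup G)
    (hU : IsOpen (U : Set G)) : U.FiniteIndex := by
  haveI : DiscreteTopology (G ⧸ U) := QuotientGroup.discreteTopology hU
  haveI : Finite (G ⧸ U) := finite_of_compact_of_discrete
  exact Subgroup.finiteIndex_of_finite_quotient

end FiniteIndex

/-! ## The levels of an Euler system -/

section Levels

variable (K : Type u) [Field K] [NumberField K] (ι : Type w) [Preorder ι] [OrderBot ι]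

/-- **The levels of an Euler system over `K`** (the data `(𝒦, N)` of Rubin's Def. 2.1.1 in the
shape of his Remark 2.1.4), as subgroups of `Γ_K = Gal(K̄/K)`:
* `primes` — the usable ("tame") primes of `K` (Rubin: the primes `q ∤ N`; Mazur–Rubin: `𝒫`);
* `pLevel : ι → Subgroup Γ_K` — the `K_∞`-direction: `pLevel i = Gal(K̄/F_i)` for the finite
  layers `K = F_⊥ ⊂ F_i ⊂ K_∞` (antitone in `i`; `ι = ℕ` for a `ℤ_p`-extension or for the tower
  `K(μ_{p^k})`);
* `tameLevel q = Gal(K̄/K(q))` for the auxiliary abelian extension `K(q)/K` attached to a usable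
  prime `q` (Rubin: the maximal `p`-extension of `K` in the ray class field modulo `q`; over `ℚ`
  also `ℚ(μ_q)`); its value at `q ∉ primes` is irrelevant;
* axioms: all levels are open with abelian quotient (`𝒦/K` is an abelian extension, so
  `Fr_q ∈ Gal(F/K)` is well defined), `F_i/K` is unramified at all usable primes (`K_∞/K` is
  unramified outside `p ∣ N`) and `K(q)/K` is unramified at all usable primes `≠ q` (it lies in the
  ray class field modulo `q`).
Ref: Rubin, *Euler Systems* (2000), Def. 2.1.1 (i)–(ii), Remark 2.1.4 (`𝒦_min = K_∞ ∏ K(q)`,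
`F(r) = F K(q₁)⋯K(q_k)`). [cite: Rubin2000, Def. 2.1.1 and Remark 2.1.4] -/
structure EulerSystemLevels where
  /-- The usable primes (`q ∤ N`). -/
  primes : Set (HeightOneSpectrum (𝓞 K))
  /-- The `K_∞`-direction levels `Gal(K̄/F_i)`. -/
  pLevel : ι → Subgroup (absoluteGaloisGroup K)
  /-- The bottom layer is `K` itself. -/
  pLevel_bot : pLevel ⊥ = ⊤
  /-- The layers increase with `i` (the subgroups decrease). -/
  pLevel_antitone : Antitone pLevel
  /-- Each `F_i/K` is a finite extension. -/
  isOpen_pLevel : ∀ i, IsOpen (pLevel i : Set (absoluteGaloisGroup K))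
  /-- Each `F_i/K` is abelian. -/
  commutator_le_pLevel : ∀ i, commutator (absoluteGaloisGroup K) ≤ pLevel i
  /-- Each `F_i/K` is unramified at the usable primes. -/
  pLevel_unramifiedAt : ∀ i, ∀ v ∈ primes, SubgroupIsUnramifiedAt K (pLevel i) v
  /-- The tame levels `Gal(K̄/K(q))`. -/
  tameLevel : HeightOneSpectrum (𝓞 K) → Subgroup (absoluteGaloisGroup K)
  /-- Each `K(q)/K` is a finite extension. -/
  isOpen_tameLevel : ∀ q, IsOpen (tameLevel q : Set (absoluteGaloisGroup K))
  /-- Each `K(q)/K` is abelian. -/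
  commutator_le_tameLevel : ∀ q, commutator (absoluteGaloisGroup K) ≤ tameLevel q
  /-- `K(q)/K` is unramified at the usable primes other than `q`. -/
  tameLevel_unramifiedAt : ∀ q ∈ primes, ∀ v ∈ primes, v ≠ q → SubgroupIsUnramifiedAt K (tameLevel q) v

namespace EulerSystemLevels

variable {K ι} (L : EulerSystemLevels K ι)

/-- The index set of "squarefree ideals prime to `N`": finite sets of usable primes.
Ref: Rubin, *Euler Systems* (2000), Remark 2.1.4 (`r` squarefree, prime to `N`). [cite: Rubin2000, Remark 2.1.4] -/
def Ideals : Type u :=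
  {r : Finset (HeightOneSpectrum (𝓞 K)) // ∀ q ∈ r, q ∈ L.primes}

/-- The unit ideal `r = 1` (no tame primes). [folklore] -/
def idealOne : L.Ideals :=
  ⟨∅, fun _ h ↦ absurd h (Finset.notMem_empty _)⟩

/-- Unfolding `idealOne`. [folklore] -/
@[simp]
theorem idealOne_val : L.idealOne.1 = ∅ :=
  rfl

variable {L} in
/-- Adjoining a usable prime: `r ↦ rq`. [folklore] -/
def Ideals.cons (r : L.Ideals) (q : HeightOneSpectrum (𝓞 K)) (hq : q ∈ L.primes) : L.Ideals :=
  ⟨insert q r.1, fun v hv ↦ by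
    rcases Finset.mem_insert.mp hv with rfl | hv
    · exact hq
    · exact r.2 v hv⟩

variable {L} in
/-- Unfolding `Ideals.cons`. [folklore] -/
@[simp]
theorem Ideals.cons_val (r : L.Ideals) (q : HeightOneSpectrum (𝓞 K)) (hq : q ∈ L.primes) :
    (r.cons q hq).1 = insert q r.1 :=
  rfl

/-- **The level `Gal(K̄/F_i(r))`** of the index `(i, r)`: the compositum
`F_i(r) = F_i · K(q₁) ⋯ K(q_k)` corresponds to the intersection
`pLevel i ⊓ ⨅_{q ∈ r} tameLevel q`.
Ref: Rubin, *Euler Systems* (2000), Remark 2.1.4. [cite: Rubin2000, Remark 2.1.4] -/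
def level (i : ι) (r : Finset (HeightOneSpectrum (𝓞 K))) : Subgroup (absoluteGaloisGroup K) :=
  L.pLevel i ⊓ ⨅ q ∈ r, L.tameLevel q

/-- Membership in `level i r`. [folklore] -/
theorem mem_level_iff {i : ι} {r : Finset (HeightOneSpectrum (𝓞 K))} {σ : absoluteGaloisGroup K} :
    σ ∈ L.level i r ↔ σ ∈ L.pLevel i ∧ ∀ q ∈ r, σ ∈ L.tameLevel q := by
  simp only [level, Subgroup.mem_inf, Subgroup.mem_iInf]

/-- The bottom level is `K` itself: `level ⊥ ∅ = Γ_K`. [folklore] -/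
@[simp]
theorem level_bot_empty : L.level ⊥ ∅ = ⊤ := by
  refine Subgroup.ext fun σ ↦ ?_
  simp [mem_level_iff, L.pLevel_bot]

/-- `Γ_K ≤ level ⊥ ∅` (the form consumed by `resLe`). [folklore] -/
theorem top_le_level_bot_empty : (⊤ : Subgroup (absoluteGaloisGroup K)) ≤ L.level ⊥ ∅ :=
  L.level_bot_empty.symm ▸ le_rfl

/-- The levels decrease in the `K_∞`-direction. [folklore] -/
theorem level_mono_left {i j : ι} (hij : i ≤ j) (r : Finset (HeightOneSpectrum (𝓞 K))) :
    L.level j r ≤ L.level i r :=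
  inf_le_inf_right _ (L.pLevel_antitone hij)

/-- The levels decrease when primes are adjoined: `Gal(K̄/F(rq)) ≤ Gal(K̄/F(r))`. [folklore] -/
theorem level_insert_le (i : ι) (r : Finset (HeightOneSpectrum (𝓞 K))) (q : HeightOneSpectrum (𝓞 K)) :
    L.level i (insert q r) ≤ L.level i r := by
  intro σ hσ
  rw [mem_level_iff] at hσ ⊢
  exact ⟨hσ.1, fun q' hq' ↦ hσ.2 q' (Finset.mem_insert_of_mem hq')⟩

/-- Every level is open (a finite intersection of open subgroups). [folklore] -/
theorem isOpen_level (i : ι) (r : Finset (HeightOneSpectrum (𝓞 K))) :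
    IsOpen (L.level i r : Set (absoluteGaloisGroup K)) := by
  have h : (L.level i r : Set (absoluteGaloisGroup K)) =
      (L.pLevel i : Set _) ∩ ⋂ q ∈ r, (L.tameLevel q : Set (absoluteGaloisGroup K)) := by
    ext σ
    simp only [SetLike.mem_coe, mem_level_iff, Set.mem_inter_iff, Set.mem_iInter]
  rw [h]
  exact (L.isOpen_pLevel i).inter (isOpen_biInter_finset fun q _ ↦ L.isOpen_tameLevel q)

/-- Every level has abelian quotient: `[Γ_K, Γ_K] ≤ level i r`. [folklore] -/
theorem commutator_le_level (i : ι) (r : Finset (HeightOneSpectrum (𝓞 K))) :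
    commutator (absoluteGaloisGroup K) ≤ L.level i r := by
  intro σ hσ
  rw [mem_level_iff]
  exact ⟨L.commutator_le_pLevel i hσ, fun q _ ↦ L.commutator_le_tameLevel q hσ⟩

/-- Every level is a normal subgroup (`Gal(K̄/F_i(r))`, `F_i(r)/K` abelian). [folklore] -/
instance normal_level (i : ι) (r : Finset (HeightOneSpectrum (𝓞 K))) : (L.level i r).Normal :=
  Subgroup.Normal.of_commutator_le (absoluteGaloisGroup K) (L.commutator_le_level i r)

/-- Every level has finite index (`F_i(r)/K` is finite): open in the compact group `Γ_K`.
[folklore] -/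
instance finiteIndex_level (i : ι) (r : Finset (HeightOneSpectrum (𝓞 K))) :
    (L.level i r).FiniteIndex :=
  finiteIndex_of_isOpen_of_compactSpace _ (L.isOpen_level i r)

/-- **`Σ ⊆ {q}` for a tame step.** The level `F_i(r)` is unramified at every usable prime not in
`r`; hence when `q` is adjoined, the only usable prime that can become ramified is `q` itself, and
in the `K_∞`-direction none can (Rubin's `Σ(F'(r)/F(r)) = ∅`, `Σ(F(rq)/F(r)) ⊆ {q}`).
Ref: Rubin, *Euler Systems* (2000), Def. 2.1.1, Remark 2.1.4. [folklore] -/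
theorem level_unramifiedAt (i : ι) (r : L.Ideals) {v : HeightOneSpectrum (𝓞 K)}
    (hv : v ∈ L.primes) (hvr : v ∉ r.1) : SubgroupIsUnramifiedAt K (L.level i r.1) v := by
  intro 𝔓 h𝔓 σ hσ
  rw [mem_level_iff]
  refine ⟨L.pLevel_unramifiedAt i v hv 𝔓 h𝔓 hσ, fun q hq ↦ ?_⟩
  have hne : v ≠ q := fun h ↦ hvr (h ▸ hq)
  exact L.tameLevel_unramifiedAt q (r.2 q hq) v hv hne 𝔓 h𝔓 hσ

end EulerSystemLevels

end Levels

/-! ## Cohomology of `T` over the levels; the operators `Fr_q⁻¹` and `P(Fr_q⁻¹ | T*; Fr_q⁻¹)` -/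

section Cohomology

variable {K : Type u} [Field K]
variable {A : Type v} [CommRing A] [TopologicalSpace A]
variable {M : Type u} [AddCommGroup M] [Module A M] [TopologicalSpace M] [IsTopologicalAddGroup M]
  [ContinuousSMul A M]

/-- The continuous-cochain Galois cohomology `H¹(U, T) = H¹(F, T)` (`F = K̄^U`) of the `p`-adic
representation `T` over the fixed field of `U ≤ Γ_K`, as a topological `A`-module (Mathlib
`continuousCohomology 1` of `T|U`; App. B of Rubin: for `T = lim T/p^n` this is also
`lim H¹(F, T/p^n)`).
Ref: Rubin, *Euler Systems* (2000), Ch. I §2, App. B §2. [cite: Rubin2000, Ch. I §2 and App. B §2] -/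
abbrev H1 (T : GaloisRep K A M) (U : Subgroup (absoluteGaloisGroup K)) : TopModuleCat A :=
  continuousCohomology 1 (subgroupRep T.toTopRep U)

/-- The action of `σ⁻¹` on `H¹(U, T)` for `σ ∈ Γ_K` and `U` normal (`conjMap`), as an `A`-linear
endomorphism: for `σ = Fr_q` an arithmetic Frobenius this is Rubin's operator `Fr_q⁻¹` on
`H¹(F, T)`.  Ref: Rubin, *Euler Systems* (2000), Def. 2.1.1; Serre, *Local Fields* (1979),
VII.§5. [folklore] -/
def frobeniusInvOp (T : GaloisRep K A M) (U : Subgroup (absoluteGaloisGroup K)) [U.Normal]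
    (σ : absoluteGaloisGroup K) : Module.End A (H1 T U) :=
  (conjMap T.toTopRep U σ⁻¹ 1).hom.toLinearMap

/-- **`Fr_q⁻¹` on `H¹(F, T)` only depends on the coset `Fr_q · Gal(K̄/F)`:** if
`σ⁻¹ σ' ∈ U` then `σ` and `σ'` induce the same operator (inner automorphisms act trivially,
`conjMap_one_apply_of_mem`).  In particular two Frobenius elements at the same prime `𝔓` (they
differ by inertia) act alike as soon as `I_𝔓 ≤ U`.
Ref: Serre, *Local Fields* (1979), VII.§5, Prop. 3; Rubin, *Euler Systems* (2000), Ch. II §1.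
[folklore] -/
theorem frobeniusInvOp_eq_of_inv_mul_mem (T : GaloisRep K A M) (U : Subgroup (absoluteGaloisGroup K))
    [U.Normal] {σ σ' : absoluteGaloisGroup K} (h : σ⁻¹ * σ' ∈ U) :
    frobeniusInvOp T U σ' = frobeniusInvOp T U σ := by
  have h' : (σ⁻¹)⁻¹ * σ'⁻¹ ∈ U := by
    have hc := ‹U.Normal›.conj_mem _ (U.inv_mem h) σ
    rw [inv_inv]
    simpa [mul_assoc] using hc
  refine LinearMap.ext fun c ↦ ?_
  exact conjMap_apply_one_eq_of_inv_mul_mem T.toTopRep U h' c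

open scoped commutatorElement in
/-- **`Fr_q⁻¹` on `H¹(F, T)` is independent of the prime above `q` when `F/K` is abelian:**
conjugate elements induce the same operator on `H¹(U, T)` whenever `[Γ_K, Γ_K] ≤ U`
(`σ⁻¹ · τστ⁻¹ = [σ⁻¹, τ]`).  Ref: Rubin, *Euler Systems* (2000), Ch. II §1 (`𝒦/K` abelian).
[folklore] -/
theorem frobeniusInvOp_conj_eq (T : GaloisRep K A M) (U : Subgroup (absoluteGaloisGroup K)) [U.Normal]
    (hU : commutator (absoluteGaloisGroup K) ≤ U) (σ τ : absoluteGaloisGroup K) :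
    frobeniusInvOp T U (τ * σ * τ⁻¹) = frobeniusInvOp T U σ := by
  refine frobeniusInvOp_eq_of_inv_mul_mem T U (hU ?_)
  have e : σ⁻¹ * (τ * σ * τ⁻¹) = ⁅σ⁻¹, τ⁆ := by
    rw [commutatorElement_def, inv_inv]
    group
  rw [e, commutator_def]
  exact Subgroup.commutator_mem_commutator (Subgroup.mem_top _) (Subgroup.mem_top _)

variable [Module.Free A M] [Module.Finite A M]

/-- **The operator `P(Fr_q⁻¹ | T*; Fr_q⁻¹)` on `H¹(F, T)`**: Rubin's Euler factor
`rubinEulerFactor T χ_cyc σ ∈ A[X]` (for `σ = Fr_q`) evaluated at the operator `Fr_q⁻¹`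
(`Polynomial.aeval`).  Ref: Rubin, *Euler Systems* (2000), Def. 2.1.1. [cite: Rubin2000, Def. 2.1.1] -/
def eulerFactorOp (T : GaloisRep K A M) (U : Subgroup (absoluteGaloisGroup K)) [U.Normal] (p : ℕ)
    [Fact p.Prime] [Algebra ℤ_[p] A] (σ : absoluteGaloisGroup K) : Module.End A (H1 T U) :=
  Polynomial.aeval (frobeniusInvOp T U σ)
    (rubinEulerFactor T.toRepresentation (cyclotomicCharacterToUnits K p A) σ)

/-- `P(Fr_q⁻¹ | T*; Fr_q⁻¹)` for two elements `σ, σ'` with `σ⁻¹ σ' ∈ U` and the same Euler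
polynomial (e.g. two Frobenius elements at `𝔓 ∣ q` with `I_𝔓 ≤ U` and `T` unramified at `q`)
coincide.  Ref: Rubin, *Euler Systems* (2000), Ch. II §1 ("the determinant is well-defined
because `T*` is unramified at `q`"). [folklore] -/
theorem eulerFactorOp_eq_of_inv_mul_mem (T : GaloisRep K A M) (U : Subgroup (absoluteGaloisGroup K))
    [U.Normal] (p : ℕ) [Fact p.Prime] [Algebra ℤ_[p] A] {σ σ' : absoluteGaloisGroup K}
    (h : σ⁻¹ * σ' ∈ U)
    (hP : rubinEulerFactor T.toRepresentation (cyclotomicCharacterToUnits K p A) σ' =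
      rubinEulerFactor T.toRepresentation (cyclotomicCharacterToUnits K p A) σ) :
    eulerFactorOp T U p σ' = eulerFactorOp T U p σ := by
  rw [eulerFactorOp, eulerFactorOp, hP, frobeniusInvOp_eq_of_inv_mul_mem T U h]

end Cohomology

/-! ## The definition of an Euler system -/

section Definition

variable {K : Type u} [Field K] [NumberField K] {ι : Type w} [Preorder ι] [OrderBot ι]
variable {A : Type v} [CommRing A] [TopologicalSpace A]
variable {M : Type u} [AddCommGroup M] [Module A M] [TopologicalSpace M] [IsTopologicalAddGroup M]
  [ContinuousSMul A M] [Module.Free A M] [Module.Finite A M]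
variable (L : EulerSystemLevels K ι) (T : GaloisRep K A M) (p : ℕ) [Fact p.Prime] [Algebra ℤ_[p] A]

/-- The corestriction `Cor : H¹(F_j(r), T) → H¹(F_i(r), T)` in the `K_∞`-direction (`i ≤ j`).
Ref: Rubin, *Euler Systems* (2000), Def. 2.1.1. [folklore] -/
def EulerSystemLevels.coresP {i j : ι} (hij : i ≤ j) (r : Finset (HeightOneSpectrum (𝓞 K))) :
    H1 T (L.level j r) →ₗ[A] H1 T (L.level i r) :=
  haveI : Fintype (L.level i r ⧸ (L.level j r).subgroupOf (L.level i r)) := Fintype.ofFinite _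
  coresLe T.toTopRep (L.level_mono_left hij r) (L.isOpen_level j r)

/-- The corestriction `Cor : H¹(F_i(rq), T) → H¹(F_i(r), T)` in the tame direction (adjoining
the usable prime `q` to `r`).  Ref: Rubin, *Euler Systems* (2000), Def. 2.1.1. [folklore] -/
def EulerSystemLevels.coresCons (i : ι) (r : L.Ideals) (q : HeightOneSpectrum (𝓞 K))
    (hq : q ∈ L.primes) : H1 T (L.level i (r.cons q hq).1) →ₗ[A] H1 T (L.level i r.1) :=
  haveI : Fintype (L.level i r.1 ⧸ (L.level i (r.cons q hq).1).subgroupOf (L.level i r.1)) :=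
    Fintype.ofFinite _
  coresLe T.toTopRep (L.level_insert_le i r.1 q) (L.isOpen_level i (r.cons q hq).1)

/-- **Euler system** (Rubin, *Euler Systems*, Def. 2.1.1, in the form of Remark 2.1.4).  A family
of continuous cohomology classes `c i r ∈ H¹(F_i(r), T)`, indexed by the layers `i` of the
`K_∞`-direction and the squarefree usable ideals `r` (`L.Ideals`), is an Euler system for `T`
over the levels `L` (prime `p`, entering through `T* = Hom(T, O(1))`) when:
* (`cores_p`) it is norm-compatible in the `K_∞`-direction: `Cor_{F_j(r)/F_i(r)} c_{j,r} = c_{i,r}`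
  for `i ≤ j` (Rubin: `Σ(F'/F) = ∅`, "Euler system classes are universal norms");
* (`cores_cons_of_unramified`) for a usable prime `q ∉ r` at which `F_i(rq)/K` is still
  unramified (`Σ = ∅`; e.g. `K(q) = K`): `Cor_{F_i(rq)/F_i(r)} c_{i,rq} = c_{i,r}`;
* (`cores_cons`) for a usable prime `q ∉ r` ramified in `F_i(rq)/K` (`Σ = {q}`):
  `Cor_{F_i(rq)/F_i(r)} c_{i,rq} = P(Fr_q⁻¹ | T*; Fr_q⁻¹) c_{i,r}` for every arithmetic Frobenius
  `Fr_q ∈ Γ_K` of `q` (`IsArithFrobAtPlace`; `eulerFactorOp`).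
See the module docstring for the conventions (arithmetic Frobenius; Rubin's `T*` Euler factor
`det(1 - Fr_q⁻¹ X | T*)`, not Mazur–Rubin's `det(1 - Fr_q X | T)`) and for what is not part of
the notion (Rubin's hypotheses on `𝒦 ⊇ K(q)`, `K_∞`, `N`).
Ref: Rubin, *Euler Systems* (2000), Def. 2.1.1, Remarks 2.1.2–2.1.4; Rubin, PCMI lectures
(2009), §4.1 (the case `K = ℚ`, `𝒩 = {r p^k}`). [cite: Rubin2000, Def. 2.1.1 and Remark 2.1.4] -/
structure IsEulerSystem (c : ∀ (i : ι) (r : L.Ideals), H1 T (L.level i r.1)) : Prop where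
  /-- Norm compatibility in the `K_∞`-direction. -/
  cores_p : ∀ {i j : ι} (hij : i ≤ j) (r : L.Ideals), L.coresP T hij r.1 (c j r) = c i r
  /-- Tame step at a prime that stays unramified: no Euler factor. -/
  cores_cons_of_unramified : ∀ (i : ι) (r : L.Ideals) (q : HeightOneSpectrum (𝓞 K))
    (hq : q ∈ L.primes), q ∉ r.1 → SubgroupIsUnramifiedAt K (L.level i (r.cons q hq).1) q →
      L.coresCons T i r q hq (c i (r.cons q hq)) = c i r
  /-- Tame step at a prime that ramifies: the Euler factor `P(Fr_q⁻¹ | T*; Fr_q⁻¹)`. -/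
  cores_cons : ∀ (i : ι) (r : L.Ideals) (q : HeightOneSpectrum (𝓞 K)) (hq : q ∈ L.primes),
    q ∉ r.1 → ¬ SubgroupIsUnramifiedAt K (L.level i (r.cons q hq).1) q →
      ∀ σ : absoluteGaloisGroup K, IsArithFrobAtPlace K q σ →
        L.coresCons T i r q hq (c i (r.cons q hq)) = eulerFactorOp T (L.level i r.1) p σ (c i r)

namespace IsEulerSystem

variable {L T p}

/-- The zero family is an Euler system. [folklore] -/
theorem zero : IsEulerSystem L T p 0 where
  cores_p _ _ := by simp only [Pi.zero_apply, map_zero]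
  cores_cons_of_unramified _ _ _ _ _ _ := by simp only [Pi.zero_apply, map_zero]
  cores_cons _ _ _ _ _ _ _ _ := by simp only [Pi.zero_apply, map_zero]

/-- Euler systems form an additive subgroup. [folklore] -/
theorem add {c c' : ∀ (i : ι) (r : L.Ideals), H1 T (L.level i r.1)} (hc : IsEulerSystem L T p c)
    (hc' : IsEulerSystem L T p c') : IsEulerSystem L T p (c + c') where
  cores_p hij r := by simp only [Pi.add_apply, map_add, hc.cores_p hij r, hc'.cores_p hij r]
  cores_cons_of_unramified i r q hq hqr hur := by
    simp only [Pi.add_apply, map_add, hc.cores_cons_of_unramified i r q hq hqr hur,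
      hc'.cores_cons_of_unramified i r q hq hqr hur]
  cores_cons i r q hq hqr hram σ hσ := by
    simp only [Pi.add_apply, map_add, hc.cores_cons i r q hq hqr hram σ hσ,
      hc'.cores_cons i r q hq hqr hram σ hσ]

/-- Euler systems are stable under the scalars `A` (Rubin: `ES(T)` is an `O`-module). [folklore] -/
theorem smul {c : ∀ (i : ι) (r : L.Ideals), H1 T (L.level i r.1)} (a : A)
    (hc : IsEulerSystem L T p c) : IsEulerSystem L T p (a • c) where
  cores_p hij r := by simp only [Pi.smul_apply, map_smul, hc.cores_p hij r]
  cores_cons_of_unramified i r q hq hqr hur := by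
    simp only [Pi.smul_apply, map_smul, hc.cores_cons_of_unramified i r q hq hqr hur]
  cores_cons i r q hq hqr hram σ hσ := by
    simp only [Pi.smul_apply, map_smul, hc.cores_cons i r q hq hqr hram σ hσ]

end IsEulerSystem

/-- **The `A`-module `ES(T)` of Euler systems** for `T` over the levels `L`.
Ref: Rubin, *Euler Systems* (2000), Def. 2.1.1; Rubin, PCMI lectures (2009), §4.1 ("Let `ES(A)`
denote the `ℤ_p[G_ℚ]`-module of Euler systems"). [cite: Rubin2000, Def. 2.1.1] -/
def EulerSystem : Submodule A (∀ (i : ι) (r : L.Ideals), H1 T (L.level i r.1)) where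
  carrier := {c | IsEulerSystem L T p c}
  zero_mem' := IsEulerSystem.zero
  add_mem' hc hc' := hc.add hc'
  smul_mem' a _ hc := IsEulerSystem.smul a hc

/-- Membership in `EulerSystem`. [folklore] -/
@[simp]
theorem mem_eulerSystem_iff {c : ∀ (i : ι) (r : L.Ideals), H1 T (L.level i r.1)} :
    c ∈ EulerSystem L T p ↔ IsEulerSystem L T p c :=
  Iff.rfl

/-- **Cyclotomic Euler system**: an Euler system whose `K_∞`-direction is a chain indexed by
`ℕ` (levels `K = F_0 ⊂ F_1 ⊂ ⋯`, index set `𝒩 = {r · p^k}` as in Rubin's Park City lectures,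
§4.1 (4.1), and Kato's Euler system on `ℚ(μ_{r p^k})`; the levels `ℚ(μ_{r p^k})` themselves are
`cyclotomicLevelsRat` of file `CyclotomicLevels`); the abbreviation of `IsEulerSystem` for
`ι = ℕ`.  Ref: Rubin, *Euler Systems* (2000), Def. 2.1.1, Remark 2.1.4; Rubin, *Euler systems and
Kolyvagin systems* (Park City lectures, 2011), §4.1, (4.1). [cite: Rubin2011, §4.1 (4.1)] -/
abbrev CyclotomicEulerSystem (L : EulerSystemLevels K ℕ) (T : GaloisRep K A M) (p : ℕ) [Fact p.Prime]
    [Algebra ℤ_[p] A] (c : ∀ (k : ℕ) (r : L.Ideals), H1 T (L.level k r.1)) : Prop :=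
  IsEulerSystem L T p c

end Definition

/-! ## The bottom class and localisation -/

section Bottom

variable {R : Type v} [Ring R] [TopologicalSpace R]
variable {G : Type u} [Group G] [TopologicalSpace G] [IsTopologicalGroup G]

/-- The tautological continuous isomorphism `G → (⊤ : Subgroup G)`. [folklore] -/
def toTopSubgroupHom : G →ₜ* (⊤ : Subgroup G) where
  toMonoidHom := Subgroup.topEquiv.symm.toMonoidHom
  continuous_toFun := continuous_id.subtype_mk _

/-- The tautological identification `Hⁿ(⊤, X) ⟶ Hⁿ(G, X)` (pull-back along `G ≅ ⊤`).
[folklore] -/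
def ofTopSubgroup (X : TopRep.{u} R G) (n : ℕ) :
    continuousCohomology n (subgroupRep X ⊤) ⟶ continuousCohomology n X :=
  ContinuousCohomology.map toTopSubgroupHom (X := subgroupRep X ⊤) (Y := X)
    (TopRep.ofHom ⟨ContinuousLinearMap.id R X, fun _ => rfl⟩) n

end Bottom

section BottomClass

variable {K : Type u} [Field K] [NumberField K] {ι : Type w} [Preorder ι] [OrderBot ι]
variable {A : Type v} [CommRing A] [TopologicalSpace A]
variable {M : Type u} [AddCommGroup M] [Module A M] [TopologicalSpace M] [IsTopologicalAddGroup M]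
  [ContinuousSMul A M] [Module.Free A M] [Module.Finite A M]
variable {L : EulerSystemLevels K ι} {T : GaloisRep K A M} {p : ℕ} [Fact p.Prime] [Algebra ℤ_[p] A]

/-- **The bottom class `c_K ∈ H¹(K, T) = H¹(Γ_K, T)`** of an Euler system: the class of index
`(⊥, 1)` (level `Gal(K̄/K) = Γ_K`, `level_bot_empty`), transported to `continuousCohomology 1 T`.
It is the class whose localisation carries the `L`-value in the applications (Rubin, Ch. II §2:
the theorems bound Selmer groups in terms of `c_K`).
Ref: Rubin, *Euler Systems* (2000), Def. 2.1.1, §2.2. [cite: Rubin2000, Def. 2.1.1] -/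
def IsEulerSystem.bottomClass {c : ∀ (i : ι) (r : L.Ideals), H1 T (L.level i r.1)}
    (_hc : IsEulerSystem L T p c) : continuousCohomology 1 T.toTopRep :=
  ofTopSubgroup T.toTopRep 1 (resLe T.toTopRep L.top_le_level_bot_empty 1 (c ⊥ L.idealOne))

end BottomClass

namespace GaloisRep

variable {K : Type u} [Field K] [NumberField K]
variable {A : Type v} [CommRing A] [TopologicalSpace A]
variable {M : Type u} [AddCommGroup M] [Module A M] [TopologicalSpace M] [IsTopologicalAddGroup M]
  [ContinuousSMul A M]

/-- **Localisation** `loc_v : Hⁿ(K, T) ⟶ Hⁿ(K_v, T)` at a finite place `v`: restriction along the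
decomposition-group embedding `Γ_{K_v} → Γ_K` (`absGaloisRestrict K K_v`, `K_v = v.adicCompletion K`,
the map along which `T.toLocal v` is defined).
Ref: Rubin, *Euler Systems* (2000), Ch. I §5 (the maps `H¹(K, ·) → H¹(K_v, ·)`). [folklore] -/
def localizeH (T : GaloisRep K A M) (v : HeightOneSpectrum (𝓞 K)) (n : ℕ) :
    continuousCohomology n T.toTopRep ⟶ continuousCohomology n (T.toLocal v).toTopRep :=
  ContinuousCohomology.map (absGaloisRestrict K (v.adicCompletion K)) (X := T.toTopRep)
    (Y := (T.toLocal v).toTopRep) (TopRep.ofHom ⟨ContinuousLinearMap.id A M, fun _ => rfl⟩) n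

end GaloisRep

section BottomValue

variable {K : Type u} [Field K] [NumberField K] {ι : Type w} [Preorder ι] [OrderBot ι]
variable {A : Type v} [CommRing A] [TopologicalSpace A]
variable {M : Type u} [AddCommGroup M] [Module A M] [TopologicalSpace M] [IsTopologicalAddGroup M]
  [ContinuousSMul A M] [Module.Free A M] [Module.Finite A M]
variable {L : EulerSystemLevels K ι} {T : GaloisRep K A M} {p : ℕ} [Fact p.Prime] [Algebra ℤ_[p] A]

/-- **"The bottom class has value `ℒ` under `Λ`."**  For a finite place `v` (in the applications
`v ∣ p`), an `A`-linear functional `Λ : H¹(K_v, T) → A` (a dual-exponential / Perrin-Riou or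
Coleman map, taken here as a parameter) and `ℒ ∈ A` (an algebraic `L`-value): the localisation at
`v` of the bottom class of the Euler system is sent to `ℒ` by `Λ`.  This is the statement-level
interface between an Euler system and special values (Rubin, Ch. VIII, esp. §3, Thm. 8.3.x:
`c_K ↦ L`-value under Perrin-Riou's map); no `p`-adic Hodge theory is formalised here.
Ref: Rubin, *Euler Systems* (2000), Ch. VIII §1–§3. [cite: Rubin2000, Ch. VIII §3] -/
def IsEulerSystem.HasBottomValue {c : ∀ (i : ι) (r : L.Ideals), H1 T (L.level i r.1)}
    (hc : IsEulerSystem L T p c) (v : HeightOneSpectrum (𝓞 K))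
    (Λ : continuousCohomology 1 (T.toLocal v).toTopRep →ₗ[A] A) (ℒ : A) : Prop :=
  Λ (T.localizeH v 1 hc.bottomClass) = ℒ

end BottomValue

end Literature.NumberTheory.GaloisRepresentations

end
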